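import Summits.KontsevichZagierPeriods.KontsevichZagierPeriods.Theses.HurwitzMicroSectors
import Summits.KontsevichZagierPeriods.KontsevichZagierPeriods.Theorems.ReductionTwoSix.Negative.Relative
import Summits.KontsevichZagierPeriods.KontsevichZagierPeriods.Theorems.HurwitzMicroSectorsDilationMove
import Literature.NumberTheory.Transcendental.BoxIntegralCatalanLevelFour

/-!
# `CatalanSectorTwoFour` (stmt-KontsevichZagierPeriods-3877, route HurwitzMicroSectors)

The item: IF `1, π², G` (`G = Σ_n (−1)ⁿ/(2n+1)²`, Catalan's constant) are `ℚ`-linearly independent,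
THEN Conjecture 1 of Kontsevich–Zagier holds on the weight-`2`, level-`4` box sector: two
representations `r r' : KZ.IntegralRep 2` on the open box `B = (0,1)²` whose integrands agree on `B`
with `P(xy)/(1 − (xy)⁴)`, `P'(xy)/(1 − (xy)⁴)` (`P, P' ∈ ℚ[t]`) and which have equal values are
`KZ.Equivalent`. The hypothesis is open (even `G ∉ ℚ` is open); the implication is proved here
unconditionally, with the engine of the level-`6` sector (`Theorems/HurwitzMicroSectorsReductionTwoSix`,
refuter kit `Theorems/ReductionTwoSix/Negative/*`) run at level `4`.

REDUCTION (in the quotient `Q = FormalRep ⧸ relations`; `cls`, `cls_add`, `cls_congr` of the kit).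
Everything is proved for an ARBITRARY family `ρ : ℚ[t] → KZ.IntegralRep 2` of canonical level-`4`
sector members (`(ρ N).domain = B`, `(ρ N).integrand = N(t)/(1−t⁴)`, `t = x₀x₁`; hypothesis `H` of
section `Family`), and such a family EXISTS by the Literature constructor `KZ.IntegralRep.ofRational`
(`exists_family`) — so this file introduces no definition and no notation.
Euclid by `X⁴ − 1`: `P = R + (X⁴−1)·Q`, `deg R < 4`.
* polynomial part: `[q(k+1)²tᵏ]_B = [q]_B` is ONE dilation `xᵢ ↦ xᵢ^{k+1}` of a constant
  (`cls_dil_monomial`, from the landed crux `DilationMove_of`), so `[(X⁴−1)·Q] = [−Σ_k Q_k/(k+1)²]`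
  (`cls_X4sub1_mul`, constant `polyConst` of the kit);
* polar part: the `m = 2` dilation gives `[4q·t^{2r+1}/(1−t⁴)] = [q·tʳ(1+t²)/(1−t⁴)]` (`cls_dil2`),
  i.e. the two level-`4` distribution relations `4H₁ = H₀ + H₂`, `4H₃ = H₁ + H₃` (so `H₁ ∼ 3H₃`,
  `H₀ + H₂ ∼ 12H₃`); exact `ℚ`-bookkeeping WITHOUT division in the group (`bookkeeping_level_four`)
  turns `Σ_{r<4} p_r H_r` into `b·(H₀+H₁+H₂+H₃) + c·(H₀ − H₂)`, `16b = 6p₀+3p₁+6p₂+p₃`, `2c = p₀−p₂`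
  (`cls_lowDegree`);
* hence `[P(t)/(1−t⁴)]_B = [a + b/(1−t) + c/(1+t²)]_B` with the normal-form numerator
  `a(1−X⁴) + b(1+X+X²+X³) + c(1−X²)` (`cls_normalForm`).
RIGIDITY. The normal form has value `a + b·π²/6 + c·G` (Literature
`BoxIntegral.box_integral_normalForm_level_four`, `∬_B dxdy/(1+x²y²) = G`), values are invariants of
the moves (`KZ.Equivalent.value_eq_holds`), and under the hypothesis equal values force equal
coefficients (`BoxIntegral.normalForm_level_four_coeff_eq`); chaining the classes closes the item
(`catalanSectorTwoFour_proof`). Only the hypothesis of the item is used; no named fact.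

References: M. Kontsevich, D. Zagier, *Periods* (2001), §1.1 (`G`-type examples), §1.2 rules (1b),
(2); J. Milnor, *On polylogarithms, Hurwitz zeta functions, and the Kubert identities*, Enseign.
Math. 29 (1983), §1 (distribution relations); S. Lang, *Cyclotomic Fields I–II* (1990), Ch. 2 §9.
-/

noncomputable section

open Set MeasureTheory Polynomial
open Literature.NumberTheory.Transcendental
open Summit.KontsevichZagierPeriods.HurwitzMicroSectors.ReductionTwoSixNegative

namespace Summit.KontsevichZagierPeriods.Theorems.HurwitzMicroSectorsCatalanSectorTwoFour

open Summit.KontsevichZagierPeriods.KontsevichZagierPeriods.Theses.HurwitzMicroSectors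
  (CatalanSectorTwoFour)

/-! ## Generic facts: the level-4 denominator on the box, and the abstract bookkeeping -/

/-- On the box `1 − t⁴ ≠ 0` (`t = x₀x₁ ∈ (0,1)`). [folklore] -/
theorem one_sub_t4_ne {x : Fin 2 → ℝ} (hx : x ∈ box) : 1 - (x 0 * x 1) ^ 4 ≠ 0 :=
  (sub_pos.mpr (t_pow_lt_one hx (by norm_num))).ne'

/-- BOOKKEEPING at level `4` (abstract skeleton, any abelian group `V`, `ℚ`-scalars only inside the
arguments, no division in `V`): if `φᵣ q` stands for the class of `[q·tʳ/(1−t⁴)]_B` (`r < 4`),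
additive in `q`, and the two `m = 2` relations `φ₁(4q) = φ₀ q + φ₂ q`, `φ₃(4q) = φ₁ q + φ₃ q` hold,
then `Σ_r φᵣ pᵣ = Σ_r φᵣ b + (φ₀ c − φ₂ c)` whenever `16b = 6p₀+3p₁+6p₂+p₃` and `2c = p₀ − p₂`
(the class of `b/(1−t) + c/(1+t²)`: `1/(1−t) = Σ_{r<4} tʳ/(1−t⁴)`, `1/(1+t²) = (1−t²)/(1−t⁴)`).
Multipliers: `μ₁ = p₀ − b − c` on `φ₀ μ − φ₁(4μ) + φ₂ μ`, `μ₂ = p₁ + 4p₀ − 5b − 4c` on `φ₁ μ − φ₃(3μ)`.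
[cite: Milnor1983, §1] -/
theorem bookkeeping_level_four {V : Type*} [AddCommGroup V] (φ₀ φ₁ φ₂ φ₃ : ℚ →+ V)
    (dil2_0 : ∀ q : ℚ, φ₁ (4 * q) = φ₀ q + φ₂ q)
    (dil2_1 : ∀ q : ℚ, φ₃ (4 * q) = φ₁ q + φ₃ q) (p₀ p₁ p₂ p₃ b c : ℚ)
    (hb : 16 * b = 6 * p₀ + 3 * p₁ + 6 * p₂ + p₃) (hc : 2 * c = p₀ - p₂) :
    φ₀ p₀ + φ₁ p₁ + φ₂ p₂ + φ₃ p₃ = (φ₀ b + φ₁ b + φ₂ b + φ₃ b) + (φ₀ c - φ₂ c) := by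
  -- the two relations as annihilators
  have kill1 : ∀ μ : ℚ, φ₀ μ - φ₁ (4 * μ) + φ₂ μ = 0 := fun μ => by
    rw [dil2_0]; abel
  have kill2 : ∀ μ : ℚ, φ₁ μ - φ₃ (3 * μ) = 0 := fun μ => by
    have e : φ₃ (3 * μ) = φ₃ (4 * μ) - φ₃ μ := by
      rw [← map_sub]; congr 1; ring
    rw [e, dil2_1]; abel
  obtain ⟨μ1, h1⟩ : ∃ μ : ℚ, μ = p₀ - b - c := ⟨_, rfl⟩
  obtain ⟨μ2, h2⟩ : ∃ μ : ℚ, μ = p₁ + 4 * p₀ - 5 * b - 4 * c := ⟨_, rfl⟩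
  have e0 : p₀ = b + c + μ1 := by rw [h1]; ring
  have e1 : p₁ = b + (μ2 - 4 * μ1) := by rw [h2, h1]; ring
  have e2 : p₂ = b - c + μ1 := by rw [h1]; linarith
  have e3 : p₃ = b + -(3 * μ2) := by rw [h2]; linarith
  rw [e0, e1, e2, e3]
  simp only [map_add, map_sub, map_neg]
  have aux : ∀ X Y K : V, K = 0 → X = Y + K → X = Y := by
    intro X Y K hK h; rw [h, hK, add_zero]
  refine aux _ _ _ (show (φ₀ μ1 - φ₁ (4 * μ1) + φ₂ μ1) + (φ₁ μ2 - φ₃ (3 * μ2)) = 0 by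
    rw [kill1, kill2, add_zero]) ?_
  abel

/-! ## Existence of the canonical level-4 sector members `[box, N(t)/(1 − t⁴)]` -/

/-- Evaluation of the two-variable numerator: `N(X₀X₁)(x) = N(x₀x₁)`. [folklore] -/
theorem aeval_num (N : ℚ[X]) (x : Fin 2 → ℝ) :
    MvPolynomial.aeval x
        (Polynomial.aeval (MvPolynomial.X 0 * MvPolynomial.X 1 : MvPolynomial (Fin 2) ℚ) N) =
      Polynomial.aeval (x 0 * x 1) N := by
  rw [← Polynomial.aeval_algHom_apply]
  simp

/-- Every level-`4` sector integrand `N(t)/(1 − t⁴)` is integrable on the box: a finite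
`ℚ`-combination of the Hurwitz kernels `tᵏ/(1 − t⁴)` (Literature
`BoxIntegral.integrableOn_box_pow_div_one_sub_pow`). [folklore] -/
theorem integrableOn_sector4 (N : ℚ[X]) :
    IntegrableOn (fun x : Fin 2 → ℝ => Polynomial.aeval (x 0 * x 1) N / (1 - (x 0 * x 1) ^ 4))
      box := by
  have hsum : IntegrableOn (fun x : Fin 2 → ℝ => ∑ i ∈ Finset.range (N.natDegree + 1),
      (N.coeff i : ℝ) * ((x 0 * x 1) ^ i / (1 - (x 0 * x 1) ^ 4))) box volume :=
    integrable_finsetSum _ fun i _ =>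
      (BoxIntegral.integrableOn_box_pow_div_one_sub_pow (by norm_num : 1 ≤ 4) i).const_mul _
  refine hsum.congr_fun (fun x _ => ?_) measurableSet_box
  rw [Polynomial.aeval_eq_sum_range, Finset.sum_div]
  refine Finset.sum_congr rfl fun i _ => ?_
  rw [Algebra.smul_def, eq_ratCast, mul_div_assoc]

/-- **A canonical family exists**: there is `ρ : ℚ[t] → KZ.IntegralRep 2` with `(ρ N).domain` the
open box and `(ρ N).integrand x = N(x₀x₁)/(1 − (x₀x₁)⁴)`, namely the Literature constructor
`KZ.IntegralRep.ofRational` on the numerator `N(X₀X₁)` and the denominator `1 − (X₀X₁)⁴`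
(non-vanishing on the box, `ℚ`-semialgebraic box `isSemialgebraic_box`, integrable by
`integrableOn_sector4`). In particular the hypothesis class of the item is inhabited for every `P`.
[cite: KontsevichZagier2001, §1.1] -/
theorem exists_family : ∃ ρ : ℚ[X] → KZ.IntegralRep 2, (∀ N, (ρ N).domain = box) ∧
    ∀ (N : ℚ[X]) (x : Fin 2 → ℝ),
      (ρ N).integrand x = Polynomial.aeval (x 0 * x 1) N / (1 - (x 0 * x 1) ^ 4) := by
  have hden : ∀ x : Fin 2 → ℝ, MvPolynomial.aeval x
      (1 - (MvPolynomial.X 0 * MvPolynomial.X 1 : MvPolynomial (Fin 2) ℚ) ^ 4) =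
        1 - (x 0 * x 1) ^ 4 := fun x => by simp
  have hq : ∀ x ∈ box, MvPolynomial.aeval x
      (1 - (MvPolynomial.X 0 * MvPolynomial.X 1 : MvPolynomial (Fin 2) ℚ) ^ 4) ≠ 0 :=
    fun x hx => by rw [hden]; exact one_sub_t4_ne hx
  refine ⟨fun N => KZ.IntegralRep.ofRational box
      (Polynomial.aeval (MvPolynomial.X 0 * MvPolynomial.X 1 : MvPolynomial (Fin 2) ℚ) N)
      (1 - (MvPolynomial.X 0 * MvPolynomial.X 1 : MvPolynomial (Fin 2) ℚ) ^ 4)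
      isSemialgebraic_box hq
      ((integrableOn_sector4 N).congr_fun (fun x _ => by rw [aeval_num, hden]) measurableSet_box),
    fun N => KZ.IntegralRep.domain_ofRational _ _ _ _ _ _, fun N x => ?_⟩
  rw [KZ.IntegralRep.integrand_ofRational]
  exact congrArg₂ (· / ·) (aeval_num N x) (hden x)

/-! ## Reduction for an arbitrary canonical family `ρ` -/

section Family

variable {ρ : ℚ[X] → KZ.IntegralRep 2}

/-- Equal numerators give equal classes. [folklore] -/
theorem cls_rho_congr {N N' : ℚ[X]} (h : N = N') : cls (ρ N) = cls (ρ N') := by rw [h]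

variable (H : (∀ N, (ρ N).domain = box) ∧
  ∀ (N : ℚ[X]) (x : Fin 2 → ℝ),
    (ρ N).integrand x = Polynomial.aeval (x 0 * x 1) N / (1 - (x 0 * x 1) ^ 4))
include H

/-- Integrand additivity (rule 1b) in the quotient by the moves:
`cls [N₁ + N₂] = cls [N₁] + cls [N₂]`. [cite: KontsevichZagier2001, §1.2 rule (1)] -/
theorem cls_rho_add (N₁ N₂ : ℚ[X]) : cls (ρ (N₁ + N₂)) = cls (ρ N₁) + cls (ρ N₂) :=
  cls_add _ _ _ ((H.1 N₁).trans (H.1 _).symm) ((H.1 N₂).trans (H.1 _).symm) fun x _ => by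
    rw [Pi.add_apply, H.2, H.2, H.2, map_add, add_div]

/-- The sector map `N ↦ cls [box, N(t)/(1−t⁴)]` as an additive homomorphism `ℚ[X] →+ Q`
(integrand additivity). [cite: KontsevichZagier2001, §1.2 rule (1)] -/
theorem exists_addHom : ∃ S : ℚ[X] →+ Q, ∀ N, S N = cls (ρ N) :=
  ⟨AddMonoidHom.mk' (fun N => cls (ρ N)) (cls_rho_add H), fun _ => rfl⟩

/-- Every member of the level-`4` sector (domain the open box, integrand `= P(t)/(1−t⁴)` on it) has
the class of the canonical member `ρ P` (congruence `cls_congr`: integrand additivity against a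
zero representation). [cite: KontsevichZagier2001, §1.2 rule (1)] -/
theorem cls_eq_rho (r : KZ.IntegralRep 2) (P : ℚ[X])
    (hdom : r.domain = {x | ∀ i, x i ∈ Set.Ioo (0:ℝ) 1})
    (hint : EqOn r.integrand (fun x => Polynomial.aeval (x 0 * x 1) P / (1 - (x 0 * x 1) ^ 4))
      r.domain) :
    cls r = cls (ρ P) :=
  cls_congr r _ (by rw [H.1, hdom]; rfl) fun x hx => by rw [hint hx, H.2]

/-- ONE dilation move between two canonical level-`4` members (the `n = 2` slice of the proved crux
`DilationMove_of`): if `(ρ N).integrand x = (ρ N').integrand (xᵢᵐ)ᵢ · m² ∏ xᵢ^(m−1)` on the box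
(`m ≥ 1`) then `cls (ρ N) = cls (ρ N')`. [cite: KontsevichZagier2001, §1.2 rule (2)] -/
theorem cls_dil (m : ℕ) (hm : 1 ≤ m) (N N' : ℚ[X])
    (h : ∀ x ∈ box, (ρ N).integrand x =
      (ρ N').integrand (fun i => x i ^ m) * ((m : ℝ) ^ 2 * ∏ i, x i ^ (m - 1))) :
    cls (ρ N) = cls (ρ N') := by
  have hD : DilationMoveDim 2 := dilationMove_iff_forall_dim.mp
    Summit.KontsevichZagierPeriods.HurwitzMicroSectors.DilationMove.DilationMove_of 2
  have hmem := KZ.changeOfVariablesRel_subset_relations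
    (hD m hm (ρ N) (ρ N') (H.1 N) (H.1 N') fun x hx => h x (by rwa [H.1] at hx))
  rw [cls, cls, ← sub_eq_zero, ← QuotientAddGroup.mk_sub]
  exact (QuotientAddGroup.eq_zero_iff _).mpr hmem

/-- `Dil₂` at level `4`: `[4q·t^(2r+1)/(1−t⁴)] = [q·tʳ/(1−t²)] = [q·tʳ(1+t²)/(1−t⁴)]` — for `r = 0`
this is `4H₁ = H₀ + H₂`, for `r = 1` it is `4H₃ = H₁ + H₃`. [cite: Milnor1983, §1] -/
theorem cls_dil2 (q : ℚ) (r : ℕ) :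
    cls (ρ (C (4 * q) * X ^ (2 * r + 1))) = cls (ρ (C q * X ^ r * (1 + X ^ 2))) := by
  refine cls_dil H 2 (by norm_num) _ _ fun x hx => ?_
  have h4 := one_sub_t4_ne hx
  have h8 : 1 - (x 0 * x 1) ^ 8 ≠ 0 := (sub_pos.mpr (t_pow_lt_one hx (by norm_num))).ne'
  rw [H.2, H.2]
  simp only [map_mul, map_pow, map_add, map_one, Polynomial.aeval_C, Polynomial.aeval_X,
    eq_ratCast, Fin.prod_univ_two]
  rw [show (x 0 ^ 2 * x 1 ^ 2) = (x 0 * x 1) ^ 2 by ring,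
    show x 0 ^ (2 - 1) * x 1 ^ (2 - 1) = x 0 * x 1 by norm_num]
  generalize x 0 * x 1 = t at h4 h8 ⊢
  push_cast
  rw [div_mul_eq_mul_div, div_eq_div_iff h4 (by rw [← pow_mul]; exact h8)]
  rw [← pow_mul, ← pow_mul]
  have : (1 : ℝ) - t ^ (2 * 4) = (1 - t ^ 4) * (1 + t ^ 4) := by ring
  rw [this]
  ring

/-- `Dil_{k+1}` on a constant: `[q(k+1)²·tᵏ] = [q]` — every monomial is a Jacobian, so the
polynomial part needs no Newton–Leibniz move. [cite: KontsevichZagier2001, §1.2 rule (2)] -/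
theorem cls_dil_monomial (q : ℚ) (k : ℕ) :
    cls (ρ (C (q * ((k : ℚ) + 1) ^ 2) * X ^ k * (1 - X ^ 4))) = cls (ρ (C q * (1 - X ^ 4))) := by
  refine cls_dil H (k + 1) (Nat.succ_le_succ (Nat.zero_le k)) _ _ fun x hx => ?_
  have h4 := one_sub_t4_ne hx
  have hk4 : 1 - ((x 0 * x 1) ^ (k + 1)) ^ 4 ≠ 0 := by
    rw [← pow_mul]; exact (sub_pos.mpr (t_pow_lt_one hx (by positivity))).ne'
  rw [H.2, H.2]
  simp only [map_mul, map_pow, map_sub, map_one, Polynomial.aeval_C, Polynomial.aeval_X,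
    eq_ratCast, Fin.prod_univ_two, Nat.add_sub_cancel]
  rw [show (x 0 ^ (k + 1) * x 1 ^ (k + 1)) = (x 0 * x 1) ^ (k + 1) by rw [mul_pow],
    show x 0 ^ k * x 1 ^ k = (x 0 * x 1) ^ k by rw [mul_pow]]
  generalize x 0 * x 1 = t at h4 hk4 ⊢
  push_cast
  rw [mul_div_assoc, div_self h4, mul_one, mul_div_assoc, div_self hk4, mul_one]
  ring

/-- POLYNOMIAL PART by dilations only: `cls [(X⁴−1)·Q] = cls [C(−Σ_k Q_k/(k+1)²)·(1−X⁴)]`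
(`polyConst Q = Σ_k Q_k/(k+1)²`, `∬_B (xy)ᵏ = (k+1)⁻²`). [cite: KontsevichZagier2001, §1.2] -/
theorem cls_X4sub1_mul (Qt : ℚ[X]) :
    cls (ρ ((X ^ 4 - C 1) * Qt)) = cls (ρ (C (-polyConst Qt) * (1 - X ^ 4))) := by
  obtain ⟨S, hS⟩ := exists_addHom H
  rw [← hS, ← hS]
  conv_lhs => rw [Qt.as_sum_range_C_mul_X_pow, Finset.mul_sum, map_sum]
  have hk : ∀ k ∈ Finset.range (Qt.natDegree + 1),
      S ((X ^ 4 - C 1) * (C (Qt.coeff k) * X ^ k)) =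
        S (C (-(Qt.coeff k / ((k : ℚ) + 1) ^ 2)) * (1 - X ^ 4)) := by
    intro k _
    have hk1 : ((k : ℚ) + 1) ^ 2 ≠ 0 := by positivity
    have e1 : (X ^ 4 - C 1) * (C (Qt.coeff k) * X ^ k) =
        -(C (Qt.coeff k / ((k : ℚ) + 1) ^ 2 * ((k : ℚ) + 1) ^ 2) * X ^ k * (1 - X ^ 4)) := by
      rw [div_mul_cancel₀ _ hk1]; simp only [map_one]; ring
    rw [e1, map_neg, hS, cls_dil_monomial H, ← hS, ← map_neg, ← neg_mul, ← Polynomial.C_neg]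
  rw [Finset.sum_congr rfl hk, ← map_sum, ← Finset.sum_mul, ← map_sum, polyConst,
    ← Finset.sum_neg_distrib]

/-- LEVEL-4 POLAR PART: for `deg R < 4`, `cls [R] = cls [C b·(1+X+X²+X³) + C c·(1−X²)]` whenever
`16b = 6R₀+3R₁+6R₂+R₃` and `2c = R₀ − R₂` (`bookkeeping_level_four` fed with the two `m = 2`
dilations `cls_dil2`). [cite: Milnor1983, §1] -/
theorem cls_lowDegree (R : ℚ[X]) (hR : R.natDegree < 4) (b c : ℚ)
    (hb : 16 * b = 6 * R.coeff 0 + 3 * R.coeff 1 + 6 * R.coeff 2 + R.coeff 3)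
    (hc : 2 * c = R.coeff 0 - R.coeff 2) :
    cls (ρ R) = cls (ρ (C b * (1 + X + X ^ 2 + X ^ 3) + C c * (1 - X ^ 2))) := by
  obtain ⟨S, hS⟩ := exists_addHom H
  -- `φ k q = S (q·X^k)`, additive in `q`
  obtain ⟨φ, hφ⟩ : ∃ φ : ℕ → ℚ →+ Q, ∀ (k : ℕ) (q : ℚ), φ k q = S (C q * X ^ k) :=
    ⟨fun k => S.comp (Polynomial.monomial k).toAddMonoidHom, fun k q => by
      show S (Polynomial.monomial k q) = _
      rw [Polynomial.C_mul_X_pow_eq_monomial]⟩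
  have d0 : ∀ q : ℚ, φ 1 (4 * q) = φ 0 q + φ 2 q := fun q => by
    rw [hφ, hφ, hφ, ← map_add, hS, hS]
    exact (cls_rho_congr (by ring)).trans ((cls_dil2 H q 0).trans (cls_rho_congr (by ring)))
  have d1 : ∀ q : ℚ, φ 3 (4 * q) = φ 1 q + φ 3 q := fun q => by
    rw [hφ, hφ, hφ, ← map_add, hS, hS]
    exact (cls_rho_congr (by ring)).trans ((cls_dil2 H q 1).trans (cls_rho_congr (by ring)))
  have h1 : cls (ρ R) = φ 0 (R.coeff 0) + φ 1 (R.coeff 1) + φ 2 (R.coeff 2) + φ 3 (R.coeff 3) := by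
    rw [← hS]
    conv_lhs => rw [R.as_sum_range_C_mul_X_pow' hR, map_sum]
    simp only [Finset.sum_range_succ, Finset.sum_range_zero, zero_add, hφ]
  rw [h1, bookkeeping_level_four (φ 0) (φ 1) (φ 2) (φ 3) d0 d1 _ _ _ _ b c hb hc]
  simp only [hφ, ← map_add, ← map_sub]
  rw [hS]
  exact cls_rho_congr (by ring)

/-- REDUCTION: every numerator is related to a normal form — Euclid `P = R + (X⁴−1)·Q`
(`deg R < 4`), the polynomial part by `cls_X4sub1_mul`, the polar part by `cls_lowDegree`,
reassembled by additivity. [cite: KontsevichZagier2001, §1.2] -/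
theorem cls_normalForm (P : ℚ[X]) : ∃ a b c : ℚ,
    cls (ρ P) = cls (ρ (C a * (1 - X ^ 4) + C b * (1 + X + X ^ 2 + X ^ 3) + C c * (1 - X ^ 2))) := by
  have hmD : (X ^ 4 - C 1 : ℚ[X]).Monic := Polynomial.monic_X_pow_sub_C (1 : ℚ) (by norm_num)
  have hdeg : (X ^ 4 - C 1 : ℚ[X]).natDegree = 4 := Polynomial.natDegree_X_pow_sub_C
  have hne : (X ^ 4 - C 1 : ℚ[X]) ≠ 1 := fun h => by
    have h' := congrArg Polynomial.natDegree h
    rw [hdeg, Polynomial.natDegree_one] at h'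
    exact absurd h' (by norm_num)
  obtain ⟨R, hRdef⟩ : ∃ R : ℚ[X], R = P %ₘ (X ^ 4 - C 1) := ⟨_, rfl⟩
  obtain ⟨Qt, hQdef⟩ : ∃ Qt : ℚ[X], Qt = P /ₘ (X ^ 4 - C 1) := ⟨_, rfl⟩
  have hP : P = R + (X ^ 4 - C 1) * Qt := by
    rw [hRdef, hQdef, Polynomial.modByMonic_add_div P (X ^ 4 - C 1)]
  have hR : R.natDegree < 4 := by
    have h := Polynomial.natDegree_modByMonic_lt P hmD hne
    rwa [hdeg, ← hRdef] at h
  refine ⟨-polyConst Qt, (6 * R.coeff 0 + 3 * R.coeff 1 + 6 * R.coeff 2 + R.coeff 3) / 16,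
    (R.coeff 0 - R.coeff 2) / 2, ?_⟩
  rw [hP, cls_rho_add H R ((X ^ 4 - C 1) * Qt), cls_X4sub1_mul H Qt,
    cls_lowDegree H R hR ((6 * R.coeff 0 + 3 * R.coeff 1 + 6 * R.coeff 2 + R.coeff 3) / 16)
      ((R.coeff 0 - R.coeff 2) / 2) (by ring) (by ring), ← cls_rho_add H]
  exact cls_rho_congr (by ring)

/-- On the box the normal-form member has integrand `a + b/(1−t) + c/(1+t²)`
(`1−t⁴ = (1−t)(1+t+t²+t³) = (1−t²)(1+t²)`). [folklore] -/
theorem rho_integrand_nf (a b c : ℚ) {x : Fin 2 → ℝ} (hx : x ∈ box) :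
    (ρ (C a * (1 - X ^ 4) + C b * (1 + X + X ^ 2 + X ^ 3) + C c * (1 - X ^ 2))).integrand x =
      (a : ℝ) + b / (1 - x 0 * x 1) + c / (1 + (x 0 * x 1) ^ 2) := by
  have h4 := one_sub_t4_ne hx
  have h1 := one_sub_t_ne hx
  have h2 : 1 + (x 0 * x 1) ^ 2 ≠ 0 := by positivity
  rw [H.2]
  simp only [map_add, map_mul, map_sub, map_pow, map_one, Polynomial.aeval_C, Polynomial.aeval_X,
    eq_ratCast]
  generalize x 0 * x 1 = t at h4 h1 h2 ⊢
  rw [div_eq_iff h4]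
  field_simp
  ring

/-- VALUE of the normal-form member: `a + b·π²/6 + c·G` (Literature
`BoxIntegral.box_integral_normalForm_level_four`: `∬_B dxdy/(1−xy) = π²/6`, `∬_B dxdy/(1+x²y²) = G`,
the box has volume `1`). [cite: KontsevichZagier2001, §1.1] -/
theorem value_rho_nf (a b c : ℚ) :
    (ρ (C a * (1 - X ^ 4) + C b * (1 + X + X ^ 2 + X ^ 3) + C c * (1 - X ^ 2))).value =
      a + b * (Real.pi ^ 2 / 6) + c * catalanConstant := by
  rw [← (BoxIntegral.box_integral_normalForm_level_four (a : ℝ) b c).2, KZ.IntegralRep.value, H.1]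
  exact setIntegral_congr_fun measurableSet_box fun x hx => rho_integrand_nf H a b c hx

end Family

/-! ## The item -/

/-- **`CatalanSectorTwoFour`** (item stmt-KontsevichZagierPeriods-3877 of route HurwitzMicroSectors):
if `1, π², G = Σ(−1)ⁿ/(2n+1)²` are `ℚ`-linearly independent, then two representations on the open
box `(0,1)²` with integrands `P(xy)/(1−(xy)⁴)`, `P'(xy)/(1−(xy)⁴)` (`P, P' ∈ ℚ[t]`) and equal values
are KZ-equivalent. Proof: fix a canonical family (`exists_family`); both classes reduce to normal
forms (`cls_normalForm`: integrand additivity and the dilations `m = 2`, `m = k+1` only), whose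
values `a + bπ²/6 + cG` agree by soundness (`KZ.Equivalent.value_eq_holds`); the hypothesis compares
coefficients (`BoxIntegral.normalForm_level_four_coeff_eq`), so the two normal forms coincide.
[cite: KontsevichZagier2001, §1.2] -/
theorem catalanSectorTwoFour_proof : CatalanSectorTwoFour := by
  intro hind r r' P P' hdom hdom' hint hint' hv
  obtain ⟨ρ, H⟩ := exists_family
  obtain ⟨a, b, c, e⟩ := cls_normalForm H P
  obtain ⟨a', b', c', e'⟩ := cls_normalForm H P'
  have h1 := (cls_eq_rho H r P hdom hint).trans e
  have h1' := (cls_eq_rho H r' P' hdom' hint').trans e'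
  have v : r.value = a + b * (Real.pi ^ 2 / 6) + c * catalanConstant := by
    rw [← value_rho_nf H a b c]
    exact KZ.Equivalent.value_eq_holds (cls_eq_iff.mp h1)
  have v' : r'.value = a' + b' * (Real.pi ^ 2 / 6) + c' * catalanConstant := by
    rw [← value_rho_nf H a' b' c']
    exact KZ.Equivalent.value_eq_holds (cls_eq_iff.mp h1')
  have heq : (a : ℝ) + b * (Real.pi ^ 2 / 6) + c * catalanConstant =
      a' + b' * (Real.pi ^ 2 / 6) + c' * catalanConstant := by rw [← v, ← v', hv]
  obtain ⟨ha, hb, hc⟩ := BoxIntegral.normalForm_level_four_coeff_eq hind heq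
  subst ha hb hc
  exact cls_eq_iff.mp (h1.trans h1'.symm)

end Summit.KontsevichZagierPeriods.Theorems.HurwitzMicroSectorsCatalanSectorTwoFour

end
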